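import Mathlib
import Literature.Analysis.FluidPDE.TaoLocalisationHolds
import Literature.Analysis.FluidPDE.TaoBoundedTotalSpeedDischarge
import Literature.Analysis.FluidPDE.TaoUnitViscosity
import Literature.Analysis.FluidPDE.AxisymQuotientRayAverage
import Literature.Analysis.FluidPDE.OseenHeatLpBounds
import Summits.NavierStokesRegularity.NavierStokesRegularity.Theses.SwallowedContinuum
import HarnessLib

/-!
# `SwallowedContinuum.EndpointMapExists` — the Lagrangian flow of a classical Leray–Hopf solution
  on `[0, T)` and its uniform limit at `T` (item stmt-NavierStokesRegularity-17615)

**Statement.** `ν > 0`, `T > 0`, `(u, p)` classical on `ℝ³ × [0, T)`, Leray–Hopf on `[0, T]` from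
its rapidly decaying datum. Then there are a flow map `X : ℝ → ℝ³ → ℝ³` and an endpoint map
`Xs : ℝ³ → ℝ³` with `X 0 a = a`, `∂ₜ X(t, a) = u(t, X(t, a))` on `[0, T)` (one-sided at `t = 0`),
and `X(t, ·) → Xs` UNIFORMLY on `ℝ³` as `t ↑ T`.

PROOF (the route of the item's docstring, every analytic input a theorem of the tree).
1. *Sub-slab bounds.* On every closed slab `[0, T'] ⊂ [0, T)` the solution lies in Tao's class
   (`tao2011_hasBoundedSobolevNormsOn_holds`, finite energy from `IsLerayHopfOn.lintegral_enorm_sq_le`),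
   so `u` and `∇u` are bounded there (`HasBoundedSobolevNormsOn.exists_forall_norm_iteratedFDeriv_le`,
   Sobolev embedding); hence `u(t, ·)` is globally Lipschitz, uniformly in `t ∈ [0, T']`.
2. *Trajectories.* Picard–Lindelöf (Mathlib `IsPicardLindelof`) on `[0, T_n]`,
   `T_n = T(n+1)/(n+2)`, for every label `a`; uniqueness (`ODE_solution_unique_of_mem_Icc_right`)
   makes the trajectories on different slabs agree, and `X t a` is the trajectory on the slab
   `[0, T_{N(t)}]`, `N(t) = ⌈T/(T - t)⌉₊`, so `t < T_{N(t)}`.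
3. *Uniform Cauchy property.* `‖X(t', a) - X(t, a)‖ ≤ ∫_t^{t'} ‖u(s)‖_{L^∞} ds` (fundamental theorem
   of calculus along the trajectory; `‖u(s, x)‖ ≤ ‖u(s)‖_{L^∞}` for continuous slices), and the
   TOTAL SPEED IS BOUNDED: `∫₀^{T'} ‖u(s)‖_{L^∞} ds ≤ K(ν)(E^{1/2} T^{1/4} + E)` uniformly in `T' < T`
   — Tao 2013 Prop. 9.1, discharged in the tree (`tao2011_boundedTotalSpeed_unit_holds`, ν-scaled by
   `tao2011_boundedTotalSpeed_of_unit`). A bounded monotone primitive is Cauchy at `T⁻`, uniformly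
   in the label.
4. *Limit.* Completeness of `ℝ³` gives the pointwise limits `Xs a`; a uniformly Cauchy family
   converging pointwise converges uniformly (`UniformCauchySeqOn.tendstoUniformlyOn_of_tendsto`).

HONEST FRAMING: existence of the Lagrangian endpoint map for a HYPOTHETICAL solution on `[0, T)`;
at a regular time this is classical ODE theory, and nothing here says whether `T` is singular.
Nothing here bears on the regularity problem itself.
-/

noncomputable section

set_option linter.dupNamespace false

namespace Summit.NavierStokesRegularity.NavierStokesRegularity.Theorems

open MeasureTheory Set Filter Topology Metric Function Literature.Analysis.FluidPDE
open scoped NNReal ENNReal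

namespace EndpointMap

variable {ν T : ℝ} {u : ℝ → EuclideanSpace ℝ (Fin 3) → EuclideanSpace ℝ (Fin 3)}
  {p : ℝ → EuclideanSpace ℝ (Fin 3) → ℝ}

/-- **Sub-slab bounds.** On a closed slab `[0, T'] ⊂ [0, T)` a classical Leray–Hopf solution from a
rapidly decaying datum is bounded and uniformly Lipschitz in space (Tao's class + Sobolev
embedding). [cite: Tao2011, Cor. 11.1 (arXiv Cor. 68)] -/
theorem slab_bounds (hν : 0 < ν) (hsol : IsClassicalNSSolutionOn (Ico 0 T) ν 0 u p)
    (hLH : IsLerayHopfOn T ν 0 (u 0) u) (hdec : HasRapidSpatialDecay (u 0)) {T' : ℝ}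
    (hT' : T' ∈ Ioo 0 T) :
    ∃ B : ℝ≥0, (∀ t ∈ Icc 0 T', ∀ x, ‖u t x‖ ≤ B) ∧ ∀ t ∈ Icc 0 T', LipschitzWith B (u t) := by
  have hsolc : IsClassicalNSSolutionOn (Icc 0 T') ν 0 u p :=
    hsol.mono (Icc_subset_Ico_right hT'.2) (uniqueDiffOn_Icc hT'.1)
  have hE : ∃ C : ℝ≥0, ∀ t ∈ Icc 0 T', ∫⁻ x, ‖u t x‖ₑ ^ 2 ≤ C :=
    ⟨(2 * VectorCalculus.kineticEnergy (u 0)).toNNReal, fun t ht =>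
      hLH.lintegral_enorm_sq_le hν.le ⟨ht.1, ht.2.trans hT'.2.le⟩⟩
  have hB : HasBoundedSobolevNormsOn (Icc 0 T') u :=
    tao2011_hasBoundedSobolevNormsOn_holds hν hT'.1 hsolc hE hdec
  have hsm : ∀ t ∈ Icc 0 T', ContDiff ℝ (⊤ : ℕ∞) (u t) := fun t ht => hsolc.contDiff_velocity ht
  obtain ⟨B₀, hB₀0, hB₀⟩ := hB.exists_forall_norm_iteratedFDeriv_le hsm 0
  obtain ⟨B₁, hB₁0, hB₁⟩ := hB.exists_forall_norm_iteratedFDeriv_le hsm 1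
  refine ⟨⟨max B₀ B₁, le_max_of_le_left hB₀0⟩, fun t ht x => ?_, fun t ht => ?_⟩
  · have h := hB₀ t ht x
    rw [norm_iteratedFDeriv_zero] at h
    exact h.trans (le_max_left _ _)
  · refine lipschitzWith_of_nnnorm_fderiv_le
      (((hsm t ht).differentiable (by simp)).restrictScalars ℝ) fun x => ?_
    have h := hB₁ t ht x
    rw [norm_iteratedFDeriv_one] at h
    change ‖fderiv ℝ (u t) x‖ ≤ max B₀ B₁
    exact h.trans (le_max_right _ _)

/-- **Trajectories on a closed slab** (Picard–Lindelöf for a bounded, uniformly Lipschitz,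
time-continuous field): every label `a` has an integral curve of `u` on `[0, T']` starting at `a`.
[cite: Tao2011, Prop. 9.1 (arXiv Prop. 52), context] -/
theorem exists_trajectory {T' : ℝ} (hT' : 0 ≤ T') {B : ℝ≥0}
    (hbd : ∀ t ∈ Icc 0 T', ∀ x, ‖u t x‖ ≤ B) (hlip : ∀ t ∈ Icc 0 T', LipschitzWith B (u t))
    (hcont : ∀ x, ContinuousOn (fun t => u t x) (Icc 0 T')) (a : EuclideanSpace ℝ (Fin 3)) :
    ∃ α : ℝ → EuclideanSpace ℝ (Fin 3), α 0 = a ∧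
      ∀ t ∈ Icc 0 T', HasDerivWithinAt α (u t (α t)) (Icc 0 T') t := by
  have h0 : (0 : ℝ) ∈ Icc 0 T' := ⟨le_rfl, hT'⟩
  have hPL : IsPicardLindelof u (⟨0, h0⟩ : Icc 0 T') a (B * T'.toNNReal + 1) 0 B B :=
    { lipschitzOnWith := fun t ht => (hlip t ht).lipschitzOnWith
      continuousOn := fun x _ => hcont x
      norm_le := fun t ht x _ => hbd t ht x
      mul_max_le := by
        simp only [sub_zero, sub_self, NNReal.coe_add, NNReal.coe_mul, Real.coe_toNNReal T' hT',
          NNReal.coe_one, NNReal.coe_zero, max_eq_left hT']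
        linarith }
  exact hPL.exists_eq_forall_mem_Icc_hasDerivWithinAt₀

/-- **Uniqueness of trajectories**: two integral curves of `u` on slabs `[0, b₁]`, `[0, b₂]` with
the same initial point agree on `[0, b]`, `b ≤ b₁, b₂`, when `u(t, ·)` is Lipschitz for
`t ∈ [0, b)` (Grönwall). [folklore] -/
theorem trajectory_eqOn {b b₁ b₂ : ℝ} {K : ℝ≥0} (h₁ : b ≤ b₁) (h₂ : b ≤ b₂)
    (hlip : ∀ t ∈ Ico 0 b, LipschitzWith K (u t)) {α β : ℝ → EuclideanSpace ℝ (Fin 3)}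
    (hα : ∀ t ∈ Icc 0 b₁, HasDerivWithinAt α (u t (α t)) (Icc 0 b₁) t)
    (hβ : ∀ t ∈ Icc 0 b₂, HasDerivWithinAt β (u t (β t)) (Icc 0 b₂) t) (h0 : α 0 = β 0) :
    EqOn α β (Icc 0 b) := by
  refine ODE_solution_unique_of_mem_Icc_right (v := u) (s := fun _ => univ) (K := K)
    (fun t ht => (hlip t ht).lipschitzOnWith) ?_ ?_ (fun _ _ => trivial) ?_ ?_ (fun _ _ => trivial) h0
  · exact fun t ht => (hα t ⟨ht.1, ht.2.trans h₁⟩).continuousWithinAt.mono (Icc_subset_Icc_right h₁)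
  · intro t ht
    exact (hα t ⟨ht.1, ht.2.le.trans h₁⟩).mono_of_mem_nhdsWithin
      (mem_of_superset (Icc_mem_nhdsGE (ht.2.trans_le h₁)) (Icc_subset_Icc_left ht.1))
  · exact fun t ht => (hβ t ⟨ht.1, ht.2.trans h₂⟩).continuousWithinAt.mono (Icc_subset_Icc_right h₂)
  · intro t ht
    exact (hβ t ⟨ht.1, ht.2.le.trans h₂⟩).mono_of_mem_nhdsWithin
      (mem_of_superset (Icc_mem_nhdsGE (ht.2.trans_le h₂)) (Icc_subset_Icc_left ht.1))

/-- **Displacement bound along a trajectory**: for an integral curve `γ` of `u` on `[0, b]`,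
`b < T`, and `0 ≤ t ≤ t' ≤ b`, `‖γ t' - γ t‖ₑ ≤ ∫_{(t,t']} ‖u(s)‖_{L^∞} ds` (FTC; continuous slices
are bounded by their `L^∞` norm everywhere). [cite: Tao2011, Prop. 9.1 (arXiv Prop. 52), context] -/
theorem enorm_sub_le_lintegral (hsol : IsClassicalNSSolutionOn (Ico 0 T) ν 0 u p) {b : ℝ}
    (hb : b < T) {γ : ℝ → EuclideanSpace ℝ (Fin 3)}
    (hγ : ∀ s ∈ Icc 0 b, HasDerivWithinAt γ (u s (γ s)) (Icc 0 b) s) {t t' : ℝ} (ht : 0 ≤ t)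
    (htt' : t ≤ t') (ht'b : t' ≤ b) :
    ‖γ t' - γ t‖ₑ ≤ ∫⁻ s in Ioc t t', eLpNorm (u s) ∞ volume := by
  -- continuity of `γ` and of `s ↦ u s (γ s)` on `[t, t']`
  have hγc : ContinuousOn γ (Icc t t') := fun s hs =>
    (hγ s ⟨ht.trans hs.1, hs.2.trans ht'b⟩).continuousWithinAt.mono
      (Icc_subset_Icc ht ht'b)
  have hslab : MapsTo (fun s => (s, γ s)) (Icc t t') (Ico 0 T ×ˢ univ) := fun s hs =>
    ⟨⟨ht.trans hs.1, (hs.2.trans ht'b).trans_lt hb⟩, mem_univ _⟩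
  have hfc : ContinuousOn (fun s => u s (γ s)) (Icc t t') := by
    have h := hsol.smooth_velocity.continuousOn.comp
      (continuousOn_id.prodMk hγc) hslab
    exact h
  -- FTC
  have hderiv : ∀ s ∈ Ioo t t', HasDerivWithinAt γ (u s (γ s)) (Ioi s) s := by
    intro s hs
    have h := hγ s ⟨ht.trans hs.1.le, hs.2.le.trans ht'b⟩
    exact (h.mono_of_mem_nhdsWithin (mem_nhdsWithin_of_mem_nhds
      (Icc_mem_nhds (ht.trans_lt hs.1) (hs.2.trans_le ht'b)))).hasDerivAt
        (Icc_mem_nhds (ht.trans_lt hs.1) (hs.2.trans_le ht'b)) |>.hasDerivWithinAt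
  have hint : IntervalIntegrable (fun s => u s (γ s)) volume t t' :=
    (hfc.mono (by rw [uIcc_of_le htt'])).intervalIntegrable
  have hftc := intervalIntegral.integral_eq_sub_of_hasDeriv_right_of_le htt' hγc hderiv hint
  rw [← hftc, intervalIntegral.integral_of_le htt']
  refine (enorm_integral_le_lintegral_enorm _).trans (setLIntegral_mono' measurableSet_Ioc ?_)
  intro s hs
  have hsT : s ∈ Ico 0 T := ⟨ht.trans hs.1.le, (hs.2.trans ht'b).trans_lt hb⟩
  exact enorm_le_eLpNorm_top_of_continuous (hsol.contDiff_velocity hsT).continuous (γ s)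

end EndpointMap

open EndpointMap in
/-- **Item stmt-NavierStokesRegularity-17615** (`SwallowedContinuum.EndpointMapExists`): the
Lagrangian flow map of a classical Leray–Hopf solution from a rapidly decaying datum exists on
`[0, T)` and converges uniformly as `t ↑ T` (bounded total speed, Tao 2013 Prop. 9.1).
[cite: Tao2011, Prop. 9.1 (arXiv Prop. 52)] -/
theorem swallowedContinuum_endpointMapExists_proof :
    Summit.NavierStokesRegularity.NavierStokesRegularity.Theses.SwallowedContinuum.EndpointMapExists := by
  unfold Summit.NavierStokesRegularity.NavierStokesRegularity.Theses.SwallowedContinuum.EndpointMapExists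
  intro ν T hν hT u p hsol hLH hdec
  -- the exhausting slabs `[0, T_n]`
  set Tn : ℕ → ℝ := fun n => T * ((n + 1 : ℝ) / (n + 2)) with hTn_def
  have hTn : ∀ n, Tn n ∈ Ioo 0 T := by
    intro n
    have h1 : (0 : ℝ) < (n + 1 : ℝ) / (n + 2) := by positivity
    have h2 : (n + 1 : ℝ) / (n + 2) < 1 := by
      rw [div_lt_one (by positivity)]; linarith
    exact ⟨by positivity, by nlinarith⟩
  -- slab bounds
  have hslab : ∀ n, ∃ B : ℝ≥0, (∀ t ∈ Icc 0 (Tn n), ∀ x, ‖u t x‖ ≤ B) ∧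
      ∀ t ∈ Icc 0 (Tn n), LipschitzWith B (u t) := fun n => slab_bounds hν hsol hLH hdec (hTn n)
  choose B hBsup hBlip using hslab
  -- time continuity of the field at a fixed point
  have hcont : ∀ n x, ContinuousOn (fun t => u t x) (Icc 0 (Tn n)) := by
    intro n x
    have h := hsol.smooth_velocity.continuousOn.comp (continuousOn_id.prodMk continuousOn_const)
      (fun t (ht : t ∈ Icc 0 (Tn n)) => (⟨⟨ht.1, ht.2.trans_lt (hTn n).2⟩, mem_univ x⟩ :
        (t, x) ∈ Ico 0 T ×ˢ (univ : Set (EuclideanSpace ℝ (Fin 3)))))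
    exact h
  -- trajectories on each slab
  have htraj : ∀ (a : EuclideanSpace ℝ (Fin 3)) (n : ℕ), ∃ α : ℝ → EuclideanSpace ℝ (Fin 3),
      α 0 = a ∧ ∀ t ∈ Icc 0 (Tn n), HasDerivWithinAt α (u t (α t)) (Icc 0 (Tn n)) t :=
    fun a n => exists_trajectory (hTn n).1.le (hBsup n) (hBlip n) (hcont n) a
  choose α hα0 hα using htraj
  -- consistency across slabs
  have hcons : ∀ a m n, ∀ t ∈ Icc 0 (min (Tn m) (Tn n)), α a m t = α a n t := by
    intro a m n t ht
    refine trajectory_eqOn (min_le_left _ _) (min_le_right _ _)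
      (fun s hs => hBlip m s ⟨hs.1, hs.2.le.trans (min_le_left _ _)⟩) (hα a m) (hα a n) ?_ ht
    rw [hα0, hα0]
  -- slab selector
  set N : ℝ → ℕ := fun t => ⌈T / (T - t)⌉₊ with hN_def
  have hN : ∀ t < T, t < Tn (N t) := by
    intro t ht
    have hTt : 0 < T - t := sub_pos.2 ht
    have h1 : T / (T - t) ≤ (N t : ℝ) := Nat.le_ceil _
    have h2 : T < (T - t) * ((N t : ℝ) + 2) := by
      have : T / (T - t) * (T - t) = T := div_mul_cancel₀ T hTt.ne'
      nlinarith
    show t < T * ((N t + 1 : ℝ) / (N t + 2))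
    have hpos : (0 : ℝ) < (N t : ℝ) + 2 := by positivity
    rw [← mul_div_assoc, lt_div_iff₀ hpos]
    nlinarith
  -- the flow map
  set X : ℝ → EuclideanSpace ℝ (Fin 3) → EuclideanSpace ℝ (Fin 3) := fun t a => α a (N t) t
    with hX_def
  -- on `[0, t']`, `t' < T`, the flow map is the trajectory of the slab `N t'`
  have hXeq : ∀ a, ∀ t' < T, ∀ s ∈ Icc 0 t', X s a = α a (N t') s := by
    intro a t' ht' s hs
    exact hcons a (N s) (N t') s ⟨hs.1, le_min (hN s (hs.2.trans_lt ht')).le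
      (hs.2.trans (hN t' ht').le)⟩
  -- the total-speed primitive and its bound (Tao 2013, Prop. 9.1)
  set Ψ : ℝ → ℝ≥0∞ := fun t => ∫⁻ s in Ioc 0 t, eLpNorm (u s) ∞ volume with hΨ_def
  obtain ⟨K, hK, hKbound⟩ := tao2011_boundedTotalSpeed_of_unit tao2011_boundedTotalSpeed_unit_holds hν
  set E : ℝ := VectorCalculus.kineticEnergy (u 0) with hE_def
  have hE0 : 0 ≤ E := kineticEnergy_nonneg _
  set C : ℝ≥0∞ := ENNReal.ofReal (K * (Real.sqrt E * T ^ (1 / 4 : ℝ) + E)) with hC_def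
  have hΨC : ∀ t < T, Ψ t ≤ C := by
    intro t ht
    rcases le_or_gt t 0 with h0 | h0
    · simp [hΨ_def, Ioc_eq_empty_of_le h0]
    · have hsolc : IsClassicalNSSolutionOn (Icc 0 t) ν 0 u p :=
        hsol.mono (Icc_subset_Ico_right ht) (uniqueDiffOn_Icc h0)
      have hfe : ∃ C' : ℝ≥0, ∀ s ∈ Icc 0 t, ∫⁻ x, ‖u s x‖ₑ ^ 2 ≤ C' :=
        ⟨(2 * E).toNNReal, fun s hs => hLH.lintegral_enorm_sq_le hν.le ⟨hs.1, hs.2.trans ht.le⟩⟩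
      have hE₀ : ∫⁻ x, ‖u 0 x‖ₑ ^ 2 ≤ ENNReal.ofReal (2 * E) :=
        hLH.lintegral_enorm_sq_le hν.le ⟨le_rfl, hT.le⟩
      have h1 := hKbound h0 hsolc hfe hE0 hE₀
      calc Ψ t = ∫⁻ s in Ioo 0 t, eLpNorm (u s) ∞ volume := setLIntegral_congr Ioo_ae_eq_Ioc.symm
        _ ≤ ENNReal.ofReal (K * (Real.sqrt E * t ^ (1 / 4 : ℝ) + E)) := h1
        _ ≤ C := by
          refine ENNReal.ofReal_le_ofReal ?_
          have : t ^ (1 / 4 : ℝ) ≤ T ^ (1 / 4 : ℝ) :=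
            Real.rpow_le_rpow h0.le ht.le (by norm_num)
          have hs : 0 ≤ Real.sqrt E := Real.sqrt_nonneg _
          nlinarith [mul_le_mul_of_nonneg_left this hs]
  have hCtop : C ≠ ⊤ := ENNReal.ofReal_ne_top
  -- additivity of the primitive and the displacement bound
  have hΨadd : ∀ {t t' : ℝ}, 0 ≤ t → t ≤ t' →
      Ψ t' = Ψ t + ∫⁻ s in Ioc t t', eLpNorm (u s) ∞ volume := by
    intro t t' ht htt'
    simp only [hΨ_def]
    rw [← Ioc_union_Ioc_eq_Ioc ht htt', lintegral_union measurableSet_Ioc]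
    exact Ioc_disjoint_Ioc_of_le le_rfl
  have hdisp : ∀ a {t t' : ℝ}, 0 ≤ t → t ≤ t' → t' < T →
      ‖X t' a - X t a‖ₑ ≤ ∫⁻ s in Ioc t t', eLpNorm (u s) ∞ volume := by
    intro a t t' ht htt' ht'
    rw [hXeq a t' ht' t' ⟨ht.trans htt', le_rfl⟩, hXeq a t' ht' t ⟨ht, htt'⟩]
    have hb : t' < Tn (N t') := hN t' ht'
    exact enorm_sub_le_lintegral hsol (hTn (N t')).2 (hα a (N t')) ht htt' hb.le
  -- real-valued primitive, monotone and bounded on `[0, T)`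
  have hdist : ∀ a {t t' : ℝ}, 0 ≤ t → t ≤ t' → t' < T →
      dist (X t' a) (X t a) ≤ (Ψ t').toReal - (Ψ t).toReal := by
    intro a t t' ht htt' ht'
    have hfin' : Ψ t' ≠ ⊤ := ne_top_of_le_ne_top hCtop (hΨC t' ht')
    have hI : ∫⁻ s in Ioc t t', eLpNorm (u s) ∞ volume ≠ ⊤ := by
      refine ne_top_of_le_ne_top hfin' ?_
      rw [hΨadd ht htt']; exact le_add_self
    rw [hΨadd ht htt', ENNReal.toReal_add (ne_top_of_le_ne_top hCtop (hΨC t (htt'.trans_lt ht'))) hI,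
      add_sub_cancel_left, dist_eq_norm, ← ENNReal.toReal_ofReal (norm_nonneg _),
      ofReal_norm]
    exact ENNReal.toReal_mono hI (hdisp a ht htt' ht')
  -- uniform Cauchy estimate
  have hcauchy : ∀ ε > (0 : ℝ), ∃ t₀ ∈ Ico 0 T, ∀ t ∈ Ico t₀ T, ∀ t' ∈ Ico t₀ T, ∀ a,
      dist (X t' a) (X t a) < ε := by
    intro ε hε
    set S : Set ℝ := (fun t => (Ψ t).toReal) '' Ico 0 T with hS_def
    have hSne : S.Nonempty := ⟨_, 0, ⟨le_rfl, hT⟩, rfl⟩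
    have hSbdd : BddAbove S := by
      refine ⟨C.toReal, ?_⟩
      rintro _ ⟨t, ht, rfl⟩
      exact ENNReal.toReal_mono hCtop (hΨC t ht.2)
    obtain ⟨_, ⟨t₀, ht₀, rfl⟩, hlt⟩ := exists_lt_of_lt_csSup hSne (sub_lt_self (sSup S) hε)
    refine ⟨t₀, ht₀, fun t ht t' ht' a => ?_⟩
    have hmono : ∀ {s s' : ℝ}, 0 ≤ s → s ≤ s' → s' < T → (Ψ s).toReal ≤ (Ψ s').toReal :=
      fun {s s'} hs hss' hs' => ENNReal.toReal_mono (ne_top_of_le_ne_top hCtop (hΨC s' hs'))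
        (by rw [hΨadd hs hss']; exact le_self_add)
    have hle_sup : ∀ {s : ℝ}, s ∈ Ico 0 T → (Ψ s).toReal ≤ sSup S :=
      fun {s} hs => le_csSup hSbdd ⟨s, hs, rfl⟩
    have key : ∀ {s s' : ℝ}, s ∈ Ico t₀ T → s' ∈ Ico t₀ T → s ≤ s' → dist (X s' a) (X s a) < ε := by
      intro s s' hs hs' hss'
      have h0s : 0 ≤ s := ht₀.1.trans hs.1
      calc dist (X s' a) (X s a) ≤ (Ψ s').toReal - (Ψ s).toReal := hdist a h0s hss' hs'.2
        _ ≤ sSup S - (Ψ t₀).toReal := by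
          have h1 := hle_sup (s := s') ⟨h0s.trans hss', hs'.2⟩
          have h2 := hmono ht₀.1 hs.1 hs.2
          linarith
        _ < ε := by linarith
    rcases le_total t t' with h | h
    · exact key ht ht' h
    · rw [dist_comm]; exact key ht' ht h
  -- uniform Cauchy filter statement and the limit
  have hUC : UniformCauchySeqOn X (𝓝[<] T) univ := by
    intro V hV
    obtain ⟨ε, hε, hεV⟩ := Metric.mem_uniformity_dist.1 hV
    obtain ⟨t₀, ht₀, hsmall⟩ := hcauchy ε hε
    have hmem : Ioo t₀ T ∈ 𝓝[<] T := Ioo_mem_nhdsLT ht₀.2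
    filter_upwards [Filter.prod_mem_prod hmem hmem] with m hm a _
    exact hεV (hsmall m.2 ⟨hm.2.1.le, hm.2.2⟩ m.1 ⟨hm.1.1.le, hm.1.2⟩ a)
  have hlim : ∀ a, ∃ x, Tendsto (fun t => X t a) (𝓝[<] T) (𝓝 x) := fun a =>
    cauchy_map_iff_exists_tendsto.1 (hUC.cauchy_map (mem_univ a))
  choose Xs hXs using hlim
  refine ⟨X, Xs, fun a => ?_, fun a t ht => ?_, ?_⟩
  · -- initial condition
    show α a (N 0) 0 = a
    exact hα0 a (N 0)
  · -- the flow equation on `[0, T)`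
    set m := N t with hm
    have htm : t < Tn m := hN t ht.2
    have hder : HasDerivWithinAt (α a m) (u t (α a m t)) (Icc 0 (Tn m)) t := hα a m t ⟨ht.1, htm.le⟩
    have hnhd : Icc 0 (Tn m) ∈ 𝓝[Ico 0 T] t := by
      filter_upwards [self_mem_nhdsWithin, mem_nhdsWithin_of_mem_nhds (Iio_mem_nhds htm)]
        with s hs hs'
      exact ⟨hs.1, le_of_lt hs'⟩
    have hder' : HasDerivWithinAt (α a m) (u t (α a m t)) (Ico 0 T) t :=
      hder.mono_of_mem_nhdsWithin hnhd
    refine hder'.congr_of_eventuallyEq ?_ rfl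
    filter_upwards [self_mem_nhdsWithin, mem_nhdsWithin_of_mem_nhds (Iio_mem_nhds htm)]
      with s hs hs'
    exact hcons a (N s) m s ⟨hs.1, le_min (hN s hs.2).le (le_of_lt hs')⟩
  · -- uniform convergence
    exact tendstoUniformlyOn_univ.1 (hUC.tendstoUniformlyOn_of_tendsto fun a _ => hXs a)

end Summit.NavierStokesRegularity.NavierStokesRegularity.Theorems

end
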